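import Summits.CriticalPhenomena.PercolationContinuityZ3.Theorems.PercNearOneGluingNoHeavyPcintOSMSiteAssembly
import Literature.Probability.Percolation.HypercubicAxisGroupingSite
import HarnessLib

/-!
# PCINT lane, PHASE 4 (kernel second-moment oriented route, sites): the cell `p_c^site(ℤ^9) ≤ 0.1279`

Cell `prim-pcint`, seat `prim-pcint-1` (gen 13); memo `run/shared/lean/prim/pcint/T-FIBRE-ROUTE.md` §PHASE 4.

The site analogue of the Cox–Durrett second-moment bound (`OSM.siteCriticalProb_le_of_green`):
`p_c^site(ℤ^9) ≤ 1 − 1/G⁺` with the kernel-certified Green's-function bound `G⁺ = OSM.GplusQ 9 6` (exact partial sum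
`Σ_{k<54} u_k` by the row recursion `OSM.vrow` + the closed-form tail, `OSM.sum_u_le_Gplus`), checked by `decide +kernel` in
exact rational arithmetic (`OSM.checkOSMsite`).  UNCONDITIONAL; below the lane's PHASE-2 fibre cell for `d = 9`.
-/

noncomputable section

namespace Summit.CriticalPhenomena.PercolationContinuityZ3.Theorems.Pcint.OSM

open Literature.Probability.Percolation Literature.Probability.LatticeModels

/-- **The kernel check for site `ℤ^9`**: `GplusQ 9 6 · (10⁴ − 1279) ≤ 10⁴` in exact rational arithmetic. -/
theorem checkOSMsite_9 : checkOSMsite 9 6 1279 = true := by decide +kernel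

/-- **`p_c^site(ℤ^9) ≤ 0.1279`** (second-moment oriented route, sites). -/
theorem siteCriticalProb_Z9_le_1279 : siteCriticalProb (zdGraph 9) (0 : Site 9) ≤ 0.1279 :=
  (siteCriticalProb_le_of_checkOSMsite (by norm_num) (by norm_num) (by norm_num) checkOSMsite_9).trans (by norm_num)

/-- **`p_c^site(ℤ^d) ≤ 0.1279` for every `d ≥ 9`.** -/
theorem siteCriticalProb_zd_le_1279 {d : ℕ} (hd : 9 ≤ d) : siteCriticalProb (zdGraph d) (0 : Site d) ≤ 0.1279 :=
  (AxisGrouping.siteCriticalProb_zd_anti hd).trans siteCriticalProb_Z9_le_1279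

end Summit.CriticalPhenomena.PercolationContinuityZ3.Theorems.Pcint.OSM

end
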